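import Summits.Parity.GeneralizedHardyLittlewood.Theorems.LeeYangFibresRelativeDimOneTypeSingularWeightsW1
import Summits.Parity.GeneralizedHardyLittlewood.Theorems.LeeYangFibresRelativeDimOneTypeSingularWeightsW2
import Summits.Parity.GeneralizedHardyLittlewood.Theorems.LeeYangFibresRelativeDimOneTypeSingularWeightsW4
import Summits.Parity.GeneralizedHardyLittlewood.Theorems.LeeYangFibresRelativeDimOneTypeSingularWeightsW5
import HarnessLib

/-!
# Route `LeeYangFibres`, crux `RelativeDimOne` (stmt-Parity-14113), line `gallagher-backwards-split` (RESHAPED,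
# type-conditioned split): the registered stub `stub_singularWeights`

`SingularWeightFacts` (vocabulary `LeeYangFibresRelativeDimOneTypeDefs`) is the conjunction of four provable statements
about Green–Tao's local factors `β_p` of one-dimensional systems `ψ_i(n) = a_i n + b_i`, the singular-series bookkeeping
consumed by the endgame and the type-data stubs of the reshaped line:

* (W1) `…TypeSingularWeightsW1.singularWeights_W1` — the smooth scale `G_w = ∏_{p ≤ w}(1 + |β_p − 1| + t²/p²)` is
  `≤ C_t 𝔖` for non-degenerate targets with `𝔖 ≠ 0`, uniformly in `w` and in the coefficients;
* (W2) `…TypeSingularWeightsW2.singularWeights_W2` — local obstruction: `𝔖(Ψ) = 0` forces `S(Ψ, K) ≤ εN` eventually;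
* (W4) `…TypeSingularWeightsW4.singularWeights_W4` — the `w`-smooth part of the truncated singular-series spectrum at
  level `N^θ` is `∏_{p ≤ w} β_p` (exactly, once `w = ⌊log₄ N⌋/D`, `D ≥ ⌈1/θ⌉`);
* (W5) `…TypeSingularWeightsW5.singularWeights_W5` — the coprime density on a type class is the local factor.
-/

noncomputable section

namespace Summit.Parity.GeneralizedHardyLittlewood.Cruxes.RelativeDimOne.TypeSplit

/-- **`stub_singularWeights`** (registered stub of the reshaped line `gallagher-backwards-split`): the four
singular-series / weight facts (W1), (W2), (W4), (W5) of `SingularWeightFacts`, assembled from the landed hooks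
`singularWeights_W1`, `singularWeights_W2`, `singularWeights_W4`, `singularWeights_W5`. -/
theorem stub_singularWeights : SingularWeightFacts :=
  ⟨singularWeights_W1, singularWeights_W2, singularWeights_W4, singularWeights_W5⟩

end Summit.Parity.GeneralizedHardyLittlewood.Cruxes.RelativeDimOne.TypeSplit

end
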